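import Literature.Probability.RandomPlanarGeometry.SAWStripTMFinal
import Literature.Probability.RandomPlanarGeometry.SAWWordBridges
import HarnessLib

/-!
# Decoding the final strand, I: the vertex list and its step word (soundness, part 12)

Topic `Literature/Probability/RandomPlanarGeometry` (soundness of `SAWStripTM.lean`, part 12).
The cell `(c, r)` is the lattice point `ptC r₀ c r = (c + 1, r - (r₀ + 1))` and the virtual source
is the origin (`ptX`); `stepsOf L` lists the steps along a list `L` of vertices. From
`Final l r₀ cs n ν` we extract the **good vertex list** `L = ν.dropLast` (`GoodL`, `Final.goodL`:
duplicate-free, lattice-adjacent consecutive vertices, starting at the source, cells of the strip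
with positive row, last vertex in the last column) and prove, for the step word `stepsOf r₀ L`:

* `GoodL.isSAW` — it is self-avoiding (via `GoodL.traj_stepsOf`: its trajectory visits the
  `ptX L[i]`);
* `GoodL.isBridgeW` — it is a bridge with `xEnd = l`;
* `GoodL.two_le_crossings` — two distinct horizontal consecutive pairs at a column (`Horiz`) give
  at least two crossings of the corresponding gap (the input of `isIrreducible_of_crossings`);
* `GoodL.length_le` — `|L| - 2 ≤ #U` for any set `U` labelling the real consecutive pairs
  injectively (`cpair_pos_inj`), plus the `cpairs` bookkeeping `GoodL.mem_cpairs_of_real`,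
  `GoodL.real_cpair`.

Irreducibility itself, the length bound in terms of chosen edges, and the recoverability of the
trace from the word are assembled in the next part (`SAWStripTMTraces.lean`: `decode_spec`,
`decode_inj`).

## References

* I. Jensen, J. Phys. A 37 (2004) 11521–11529, §2.1.
* H. Kesten, J. Math. Phys. 4 (1963) 960–969, §4.
-/

open Literature.Probability.LatticeModels

namespace Literature.Probability.RandomPlanarGeometry.SAW

namespace StripTM

variable {l r0 : ℕ}

/-! ### Lattice points of cells; steps along a list of cells -/

/-- The lattice point of the cell `(c, r)`: `(c + 1, r - (r₀ + 1))`. [folklore] -/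
def ptC (r0 c r : ℕ) : Site 2 := ![(c : ℤ) + 1, (r : ℤ) - (r0 + 1)]

/-- The lattice point of a vertex (the virtual source is the origin; junk `0` for the sink). [folklore] -/
def ptX (r0 : ℕ) : XCell → Site 2
  | .cell c r => ptC r0 c r
  | _ => 0

/-- First coordinate of `ptC`. [folklore] -/
@[simp] theorem ptC_zero (r0 c r : ℕ) : ptC r0 c r 0 = c + 1 := rfl

/-- Second coordinate of `ptC`. [folklore] -/
@[simp] theorem ptC_one (r0 c r : ℕ) : ptC r0 c r 1 = r - (r0 + 1) := rfl

/-- `ptC` is injective. [folklore] -/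
theorem ptC_inj {r0 c r c' r' : ℕ} (h : ptC r0 c r = ptC r0 c' r') : c = c' ∧ r = r' := by
  have h0 := congrFun h 0; have h1 := congrFun h 1
  simp only [ptC_zero, ptC_one] at h0 h1
  constructor <;> omega

/-- A cell is never mapped to the origin. [folklore] -/
theorem ptC_ne_zero (r0 c r : ℕ) : ptC r0 c r ≠ 0 := by
  intro h; have := congrFun h 0; simp only [ptC_zero, Pi.zero_apply] at this; omega

/-- The steps along a list of vertices. [folklore] -/
def stepsOf (r0 : ℕ) : List XCell → List Step
  | a :: b :: t => Step.ofStep (ptX r0 a) (ptX r0 b) :: stepsOf r0 (b :: t)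
  | _ => []

/-- Length of `stepsOf`. [folklore] -/
theorem length_stepsOf (r0 : ℕ) : ∀ L : List XCell, (stepsOf r0 L).length = L.length - 1
  | [] => rfl
  | [_] => rfl
  | a :: b :: t => by
    simp only [stepsOf, List.length_cons, length_stepsOf r0 (b :: t)]
    rfl

/-- The entries of `stepsOf`. [folklore] -/
theorem getElem_stepsOf (r0 : ℕ) : ∀ (L : List XCell) (i : ℕ) (hi : i + 1 < L.length),
    (stepsOf r0 L)[i]'(by rw [length_stepsOf]; omega) = Step.ofStep (ptX r0 (L[i])) (ptX r0 (L[i + 1]))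
  | a :: b :: t, 0, _ => by simp [stepsOf]
  | a :: b :: t, i + 1, hi => by
    have := getElem_stepsOf r0 (b :: t) i (by simp at hi ⊢; omega)
    simp only [stepsOf, List.getElem_cons_succ] at this ⊢
    exact this

/-- Lattice adjacency of consecutive vertices. [folklore] -/
def AdjPt (r0 : ℕ) (a b : XCell) : Prop := (zdGraph 2).Adj (ptX r0 a) (ptX r0 b)

/-- **The trajectory of `stepsOf`**: along a chain of lattice-adjacent vertices, the walk with the
steps `stepsOf L` started at `ptX L[0]` visits the `ptX L[i]`. [folklore] -/
theorem traj_stepsOf {L : List XCell} (hL : L.IsChain (AdjPt r0)) :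
    ∀ i (hi : i < L.length), ptX r0 (L[0]'(by omega)) + traj (stepsOf r0 L) i = ptX r0 (L[i]) := by
  intro i
  induction i with
  | zero => intro hi; simp
  | succ i ih =>
    intro hi
    have hlen : i < (stepsOf r0 L).length := by rw [length_stepsOf]; omega
    rw [traj_succ _ hlen, ← add_assoc, ih (by omega), getElem_stepsOf r0 L i hi]
    have hadj : AdjPt r0 (L[i]) (L[i + 1]) := (List.isChain_iff_getElem.1 hL) i hi
    exact (Step.eq_add_vec_ofStep hadj).symm

/-! ### Good vertex lists and their words -/

/-- The combinatorial data extracted from a final strand: its list of vertices without the sink.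
[folklore] -/
structure GoodL (l r0 : ℕ) (L : List XCell) : Prop where
  /-- simple -/
  nodup : L.Nodup
  /-- consecutive vertices are lattice-adjacent -/
  chain : L.IsChain (AdjPt r0)
  /-- at least the source and the start cell -/
  two_le : 2 ≤ L.length
  /-- starts at the source -/
  head : L[0]? = some .vsrc
  /-- the sink has been removed -/
  notsnk : XCell.vsnk ∉ L
  /-- the other vertices are cells of the strip with positive row -/
  cellsOK : ∀ x ∈ L, x ≠ .vsrc → ∃ c r, x = .cell c r ∧ c < l ∧ 1 ≤ r
  /-- the last vertex is in the last column -/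
  lastcol : ∃ c r, L.getLast? = some (.cell c r) ∧ c + 1 = l

variable {cs : List Bool} {n : ℕ} {ν L : List XCell}

/-- Grid adjacency implies lattice adjacency (away from the sink). [folklore] -/
theorem adjPt_of_adj {a b : XCell} (h : Adj l r0 a b) (ha : a ≠ .vsnk) (hb : b ≠ .vsnk) : AdjPt r0 a b := by
  unfold AdjPt
  rw [zdGraph_adj_iff]
  cases a with
  | vsnk => exact absurd rfl ha
  | vsrc =>
    cases b with
    | vsnk => exact absurd rfl hb
    | vsrc => simp [Adj] at h
    | cell c r =>
      simp only [Adj] at h; obtain ⟨rfl, rfl⟩ := h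
      refine ⟨0, Or.inl ?_⟩
      funext j; fin_cases j <;> simp [ptX, ptC]
  | cell c r =>
    cases b with
    | vsnk => exact absurd rfl hb
    | vsrc =>
      simp only [Adj] at h; obtain ⟨rfl, rfl⟩ := h
      refine ⟨0, Or.inr ?_⟩
      funext j; fin_cases j <;> simp [ptX, ptC]
    | cell c' r' =>
      simp only [Adj] at h
      rcases h with ⟨rfl, h | h⟩ | ⟨rfl, h | h⟩
      · refine ⟨1, Or.inl ?_⟩; funext j; fin_cases j <;> (simp [ptX, ptC]; try omega)
      · refine ⟨1, Or.inr ?_⟩; funext j; fin_cases j <;> (simp [ptX, ptC]; try omega)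
      · refine ⟨0, Or.inl ?_⟩; funext j; fin_cases j <;> (simp [ptX, ptC]; try omega)
      · refine ⟨0, Or.inr ?_⟩; funext j; fin_cases j <;> (simp [ptX, ptC]; try omega)

/-- **A final strand, without its sink, is a good vertex list.** [folklore] -/
theorem Final.goodL (hF : Final l r0 cs n ν) : ν = ν.dropLast ++ [.vsnk] ∧ GoodL l r0 ν.dropLast := by
  have hne : ν ≠ [] := by intro h; rw [h] at hF; exact absurd hF.head (by simp)
  have e1 : ν = ν.dropLast ++ [ν.getLast hne] := (List.dropLast_append_getLast hne).symm
  have hlast : ν.getLast hne = .vsnk := by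
    have := hF.last; rw [List.getLast?_eq_some_getLast hne] at this; exact Option.some.inj this
  rw [hlast] at e1
  set L := ν.dropLast with hL
  have hnd : L.Nodup ∧ XCell.vsnk ∉ L := by
    have hnd := hF.nodup; rw [e1, List.nodup_append] at hnd
    exact ⟨hnd.1, fun h => hnd.2.2 _ h _ (List.mem_singleton_self _) rfl⟩
  have hchain : L.IsChain (AdjPt r0) := by
    have hc := hF.chain; rw [e1] at hc
    have hc1 := hc.left_of_append
    rw [List.isChain_iff_getElem] at hc1 ⊢
    intro i hi
    exact adjPt_of_adj (hc1 i hi) (fun h => hnd.2 (h ▸ List.getElem_mem _)) (fun h => hnd.2 (h ▸ List.getElem_mem _))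
  have hhead0 : ν.head? = some .vsrc := hF.head
  have hlen : 2 ≤ L.length := by
    by_contra hlt
    push Not at hlt
    have hc := hF.chain; rw [e1] at hc
    rw [e1] at hhead0
    match hL' : L, hlt with
    | [], _ => simp at hhead0
    | [a], _ =>
      simp only [List.cons_append, List.nil_append, List.head?_cons, Option.some.injEq] at hhead0
      subst hhead0; simp [Adj] at hc
  have hhead : L[0]? = some .vsrc := by
    rw [e1] at hhead0
    rw [← List.head?_eq_getElem?]
    rw [List.head?_append] at hhead0
    cases hh : L.head? with
    | none => rw [List.head?_eq_none_iff] at hh; rw [hh] at hlen; simp at hlen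
    | some a => rw [hh] at hhead0; simpa using hhead0
  have hcells : ∀ x ∈ L, x ≠ .vsrc → ∃ c r, x = .cell c r ∧ c < l ∧ 1 ≤ r := by
    intro x hx hxs
    have hxν : x ∈ ν := by rw [e1]; exact List.mem_append_left _ hx
    cases x with
    | vsrc => exact absurd rfl hxs
    | vsnk => exact absurd hx hnd.2
    | cell c r => have hp := hF.processed _ hxν; exact ⟨c, r, rfl, hp.2.1, hp.1⟩
  have hlastcol : ∃ c r, L.getLast? = some (.cell c r) ∧ c + 1 = l := by
    have hLne : L ≠ [] := by intro h; rw [h] at hlen; simp at hlen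
    have hc := hF.chain; rw [e1, List.isChain_append] at hc
    have hadj := hc.2.2 (L.getLast hLne) (List.getLast?_eq_some_getLast hLne) .vsnk rfl
    have hmem : L.getLast hLne ∈ L := List.getLast_mem hLne
    have hns : L.getLast hLne ≠ .vsrc := by
      intro h
      -- vsrc is at position 0 and L is duplicate free of length ≥ 2
      have h0 : L[0]'(by omega) = .vsrc := by
        have := (List.getElem?_eq_some_iff.1 hhead); exact this.choose_spec
      have h1 : L[L.length - 1]'(by omega) = .vsrc := by rw [← h, List.getLast_eq_getElem]
      have := (List.Nodup.getElem_inj_iff hnd.1).1 (h0.trans h1.symm)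
      omega
    obtain ⟨c, r, hcr, -, -⟩ := hcells _ hmem hns
    refine ⟨c, r, by rw [List.getLast?_eq_some_getLast hLne, hcr], ?_⟩
    rw [hcr] at hadj; simpa [Adj] using hadj
  exact ⟨e1, hnd.1, hchain, hlen, hhead, hnd.2, hcells, hlastcol⟩

/-- The vertices are mapped injectively to lattice points (away from the sink). [folklore] -/
theorem ptX_inj_of_ne {a b : XCell} (ha : a ≠ .vsnk) (hb : b ≠ .vsnk) (h : ptX r0 a = ptX r0 b) : a = b := by
  cases a with
  | vsnk => exact absurd rfl ha
  | vsrc =>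
    cases b with
    | vsnk => exact absurd rfl hb
    | vsrc => rfl
    | cell c r => exact absurd h.symm (ptC_ne_zero r0 c r)
  | cell c r =>
    cases b with
    | vsnk => exact absurd rfl hb
    | vsrc => exact absurd h (ptC_ne_zero r0 c r)
    | cell c' r' => obtain ⟨rfl, rfl⟩ := ptC_inj h; rfl

/-- The first vertex. [folklore] -/
theorem GoodL.getElem_zero (hG : GoodL l r0 L) : L[0]'(by have := hG.two_le; omega) = .vsrc :=
  (List.getElem?_eq_some_iff.1 hG.head).choose_spec

/-- **The trajectory of the word** visits the lattice points of the vertices. [folklore] -/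
theorem GoodL.traj_stepsOf (hG : GoodL l r0 L) (i : ℕ) (hi : i < L.length) :
    traj (stepsOf r0 L) i = ptX r0 (L[i]) := by
  have := StripTM.traj_stepsOf hG.chain i hi
  rw [hG.getElem_zero] at this; simpa [ptX] using this

/-- The later vertices are cells of the strip. [folklore] -/
theorem GoodL.getElem_pos (hG : GoodL l r0 L) {i : ℕ} (hi : i < L.length) (hi1 : 1 ≤ i) :
    ∃ c r, L[i] = .cell c r ∧ c < l ∧ 1 ≤ r := by
  refine hG.cellsOK _ (List.getElem_mem hi) fun h => ?_
  have := (List.Nodup.getElem_inj_iff hG.nodup).1 (h.trans hG.getElem_zero.symm)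
  omega

/-- **The word is self-avoiding.** [folklore] -/
theorem GoodL.isSAW (hG : GoodL l r0 L) : IsSAW (stepsOf r0 L) := by
  rw [isSAW_iff_injOn]
  intro i hi j hj hij
  simp only [Set.mem_setOf_eq, length_stepsOf] at hi hj
  have hl := hG.two_le
  rw [hG.traj_stepsOf i (by omega), hG.traj_stepsOf j (by omega)] at hij
  have h1 := ptX_inj_of_ne (fun h => hG.notsnk (h ▸ List.getElem_mem _))
    (fun h => hG.notsnk (h ▸ List.getElem_mem _)) hij
  exact (List.Nodup.getElem_inj_iff hG.nodup).1 h1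

/-- First coordinates along the word. [folklore] -/
theorem GoodL.xAt_spec (hG : GoodL l r0 L) {i : ℕ} (hi : i < L.length) (hi1 : 1 ≤ i) :
    ∃ c r, L[i] = .cell c r ∧ xAt (stepsOf r0 L) i = c + 1 ∧ c < l := by
  obtain ⟨c, r, hcr, hcl, -⟩ := hG.getElem_pos hi hi1
  refine ⟨c, r, hcr, ?_, hcl⟩
  rw [xAt, hG.traj_stepsOf i hi, hcr]; simp [ptX]

/-- **The word is a bridge of span `l`.** [folklore] -/
theorem GoodL.isBridgeW (hG : GoodL l r0 L) : IsBridgeW (stepsOf r0 L) ∧ xEnd (stepsOf r0 L) = l := by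
  have hl := hG.two_le
  have hend : xEnd (stepsOf r0 L) = l := by
    obtain ⟨c, r, hcr, hcl⟩ := hG.lastcol
    have hLne : L ≠ [] := by intro h; rw [h] at hl; simp at hl
    rw [List.getLast?_eq_some_getLast hLne, Option.some.injEq, List.getLast_eq_getElem] at hcr
    obtain ⟨c', r', hcr', hx, -⟩ := hG.xAt_spec (i := L.length - 1) (by omega) (by omega)
    rw [hcr] at hcr'; cases hcr'
    rw [xEnd, length_stepsOf, hx]; omega
  refine ⟨(isBridgeW_iff _).2 fun i h1 h2 => ?_, hend⟩
  rw [length_stepsOf] at h2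
  obtain ⟨c, r, -, hc, hcl⟩ := hG.xAt_spec (i := i) (by omega) h1
  rw [hc, hend]; constructor <;> omega

/-- Membership in `cpairs` by position. [folklore] -/
theorem mem_cpairs_iff_getElem {π : List XCell} {p : Sym2 XCell} :
    p ∈ cpairs π ↔ ∃ i, ∃ h : i + 1 < π.length, p = s(π[i], π[i + 1]) := by
  induction π with
  | nil => simp [cpairs]
  | cons a t ih =>
    cases t with
    | nil => simp [cpairs]
    | cons b t' =>
      simp only [cpairs, List.mem_cons, ih]
      constructor
      · rintro (rfl | ⟨i, hi, rfl⟩)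
        · exact ⟨0, by simp, rfl⟩
        · exact ⟨i + 1, by simp at hi ⊢; omega, rfl⟩
      · rintro ⟨i, hi, rfl⟩
        cases i with
        | zero => exact Or.inl rfl
        | succ i => exact Or.inr ⟨i, by simp at hi ⊢; omega, rfl⟩

/-- Consecutive pairs of a duplicate-free list at different positions differ. [folklore] -/
theorem cpair_pos_inj {π : List XCell} (hnd : π.Nodup) {i j : ℕ} (hi : i + 1 < π.length) (hj : j + 1 < π.length)
    (h : s(π[i], π[i + 1]) = s(π[j], π[j + 1])) : i = j := by
  rw [Sym2.eq_iff] at h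
  rcases h with ⟨h1, -⟩ | ⟨h1, h2⟩
  · exact (List.Nodup.getElem_inj_iff hnd).1 h1
  · have e1 := (List.Nodup.getElem_inj_iff hnd).1 h1
    have e2 := (List.Nodup.getElem_inj_iff hnd).1 h2
    omega

/-- A horizontal pair of cells between the columns `h - 1` and `h` (meaningful for `1 ≤ h`; for
`h = 0` this degenerates, and every user assumes `1 ≤ h`). [folklore] -/
def Horiz (h : ℕ) (p : Sym2 XCell) : Prop := ∃ r, p = s(XCell.cell (h - 1) r, XCell.cell h r)

/-- A horizontal consecutive pair of the vertex list is a crossing of the word. [folklore] -/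
theorem GoodL.crossing_of_horiz (hG : GoodL l r0 L) {h : ℕ} (hh : 1 ≤ h) {i : ℕ} (hi : i + 1 < L.length)
    (hp : Horiz h s(L[i], L[i + 1])) :
    (xAt (stepsOf r0 L) i = h ∧ xAt (stepsOf r0 L) (i + 1) = h + 1) ∨
      (xAt (stepsOf r0 L) i = h + 1 ∧ xAt (stepsOf r0 L) (i + 1) = h) := by
  obtain ⟨r, hr⟩ := hp
  have hx : ∀ j (hj : j < L.length) c r', L[j] = .cell c r' → xAt (stepsOf r0 L) j = c + 1 := by
    intro j hj c r' e; rw [xAt, hG.traj_stepsOf j hj, e]; simp [ptX]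
  rw [Sym2.eq_iff] at hr
  rcases hr with ⟨h1, h2⟩ | ⟨h1, h2⟩
  · left; rw [hx i (by omega) _ _ h1, hx (i + 1) hi _ _ h2]; constructor <;> omega
  · right; rw [hx i (by omega) _ _ h1, hx (i + 1) hi _ _ h2]; constructor <;> omega

/-- Two distinct indices passing a filter give length `≥ 2`. [folklore] -/
theorem two_le_length_filter {N : ℕ} {q : ℕ → Bool} {i₁ i₂ : ℕ} (hne : i₁ ≠ i₂) (h₁ : i₁ < N) (h₂ : i₂ < N)
    (hq₁ : q i₁ = true) (hq₂ : q i₂ = true) : 2 ≤ ((List.range N).filter q).length := by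
  have hsub : [i₁, i₂] ⊆ (List.range N).filter q := by
    intro x hx; simp only [List.mem_cons, List.not_mem_nil, or_false] at hx
    rw [List.mem_filter, List.mem_range]
    rcases hx with rfl | rfl; exact ⟨h₁, hq₁⟩; exact ⟨h₂, hq₂⟩
  have h12 : [i₁, i₂].Nodup := by simp [hne]
  have := List.Subperm.length_le (List.subperm_of_subset h12 hsub)
  simpa using this

/-- **Two distinct horizontal edges at a column give two crossings.** [cite: Kesten1963SAW, §4] -/
theorem GoodL.two_le_crossings (hG : GoodL l r0 L) {h : ℕ} (hh : 1 ≤ h) {p₁ p₂ : Sym2 XCell}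
    (hne : p₁ ≠ p₂) (h₁ : p₁ ∈ cpairs L) (h₂ : p₂ ∈ cpairs L) (hp₁ : Horiz h p₁) (hp₂ : Horiz h p₂) :
    2 ≤ crossings (stepsOf r0 L) h := by
  obtain ⟨i₁, hi₁, rfl⟩ := mem_cpairs_iff_getElem.1 h₁
  obtain ⟨i₂, hi₂, rfl⟩ := mem_cpairs_iff_getElem.1 h₂
  have hii : i₁ ≠ i₂ := by rintro rfl; exact hne rfl
  unfold crossings
  refine two_le_length_filter hii (by rw [length_stepsOf]; omega) (by rw [length_stepsOf]; omega) ?_ ?_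
  · have := hG.crossing_of_horiz hh hi₁ hp₁
    simpa only [Bool.or_eq_true, Bool.and_eq_true, decide_eq_true_eq] using this
  · have := hG.crossing_of_horiz hh hi₂ hp₂
    simpa only [Bool.or_eq_true, Bool.and_eq_true, decide_eq_true_eq] using this

/-- **Counting the real edges**: the number of vertices is at most the number of available
"edge labels" plus two, for any injective labelling of the real consecutive pairs. Concretely: if
every consecutive pair `s(L[i], L[i+1])` with `i ≥ 1` equals `potEdge l u'` for some `u'` in a
finite set `U`, then `|L| - 2 ≤ #U`. [folklore] -/
theorem GoodL.length_le (hG : GoodL l r0 L) (U : Finset ℕ)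
    (hU : ∀ i, 1 ≤ i → ∀ h : i + 1 < L.length, ∃ u' ∈ U, s(L[i], L[i + 1]) = potEdge l u') :
    L.length - 2 ≤ U.card := by
  classical
  -- choose a label for every position
  have hl := hG.two_le
  let f : ℕ → ℕ := fun i => if h : 1 ≤ i ∧ i + 1 < L.length then (hU i h.1 h.2).choose else 0
  have hf : ∀ i, 1 ≤ i → ∀ h : i + 1 < L.length, f i ∈ U ∧ s(L[i], L[i + 1]) = potEdge l (f i) := by
    intro i h1 h2
    simp only [f, dif_pos (And.intro h1 h2)]
    exact (hU i h1 h2).choose_spec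
  have hinj : Set.InjOn f (Finset.Ico 1 (L.length - 1) : Set ℕ) := by
    intro i hi j hj hij
    rw [Finset.coe_Ico, Set.mem_Ico] at hi hj
    have e1 := (hf i hi.1 (by omega)).2
    have e2 := (hf j hj.1 (by omega)).2
    rw [hij] at e1; rw [← e2] at e1
    exact cpair_pos_inj hG.nodup (by omega) (by omega) e1
  have hmaps : Set.MapsTo f (Finset.Ico 1 (L.length - 1) : Set ℕ) (U : Set ℕ) := by
    intro i hi
    rw [Finset.coe_Ico, Set.mem_Ico] at hi
    exact (hf i hi.1 (by omega)).1
  have := Finset.card_le_card_of_injOn f (fun i hi => hmaps hi) hinj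
  simp only [Nat.card_Ico] at this
  omega

/-- The last vertex pairs with the sink: `cpairs (L ++ [vsnk])`. [folklore] -/
theorem GoodL.cpairs_append_vsnk (hG : GoodL l r0 L) :
    ∃ c r, cpairs (L ++ [.vsnk]) = cpairs L ++ [s(.cell c r, .vsnk)] := by
  obtain ⟨c, r, hcr, -⟩ := hG.lastcol
  exact ⟨c, r, cpairs_append hcr rfl⟩

/-- Real consecutive pairs of `L ++ [vsnk]` are consecutive pairs of `L`. [folklore] -/
theorem GoodL.mem_cpairs_of_real (hG : GoodL l r0 L) {p : Sym2 XCell} (hp : p ∈ cpairs (L ++ [.vsnk]))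
    (hreal : ∀ x ∈ p, x.IsReal) : p ∈ cpairs L := by
  obtain ⟨c, r, e⟩ := hG.cpairs_append_vsnk
  rw [e, List.mem_append, List.mem_singleton] at hp
  rcases hp with hp | rfl
  · exact hp
  · exact absurd (hreal .vsnk (by simp)) (by simp [XCell.IsReal])

/-- The consecutive pairs of `L` at positions `≥ 1` are real pairs of `L ++ [vsnk]`. [folklore] -/
theorem GoodL.real_cpair (hG : GoodL l r0 L) {i : ℕ} (hi1 : 1 ≤ i) (hi : i + 1 < L.length) :
    s(L[i], L[i + 1]) ∈ cpairs (L ++ [.vsnk]) ∧ ∀ x ∈ s(L[i], L[i + 1]), x.IsReal := by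
  obtain ⟨c, r, e⟩ := hG.cpairs_append_vsnk
  refine ⟨by rw [e]; exact List.mem_append_left _ (mem_cpairs_iff_getElem.2 ⟨i, hi, rfl⟩), ?_⟩
  rw [Sym2.ball]
  obtain ⟨c₁, r₁, h₁, -, -⟩ := hG.getElem_pos (i := i) (by omega) hi1
  obtain ⟨c₂, r₂, h₂, -, -⟩ := hG.getElem_pos (i := i + 1) hi (by omega)
  rw [h₁, h₂]; exact ⟨trivial, trivial⟩

end StripTM

end Literature.Probability.RandomPlanarGeometry.SAW
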